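import Summits.Ventures.Crystal3D.Bulk.HullTriExcess
import HarnessLib

/-!
# The angle sum of a fan triangle of the hull triangulation (`triAngleSum`), as the corner sum of
# a full face of the hull rotation system; weak and strict Girard for it

HONEST FRAMING. Part of the venture `Summits/Ventures/Crystal3D` (cell `pub-crystal3d`, phase 2;
seat typer-bulk-2); generic over a finite set `X` of unit vectors with `0 ∈ interior (conv X)`
(`Bulk/HullRotSys*.lean`); nothing about GAP(1.26).

* `sum_eq_sum_image_fiber` — an abstract fibrewise summation lemma (kept abstract on purpose:
  membership goals in the concrete dart finsets must not be elaborated against computable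
  closed terms, cf. the whnf pitfall of `phase2/LEAN-FACES-DESIGN.md` §5.6);
* `triAngleSum X t` — the sum of the three fan angles of the fan triangle `t`
  (`= faceSum univ d` for any dart `d` with `faceTri X d = t`, `triAngleSum_faceTri_eq_faceSum`);
  `card_filter_faceTri_subtype` (three darts per triangle);
* `triAngleSum_sub_pi_nonneg` (seat p3's `excess_univ_nonneg`) and **`triAngleSum_sub_pi_pos`**
  (`Bulk/HullTriExcess.lean`: strict Girard).
-/

noncomputable section

namespace Summit.Ventures.Crystal3D

open Literature.Geometry.DiscreteGeometry Finset Equiv HullRotSys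

/-! ## A fibrewise summation lemma (kept abstract: membership goals in concrete dart finsets
must not be elaborated against computable closed terms) -/

/-- `Σ_{i ∈ s} f i = Σ_{j ∈ s.image g} Σ_{i ∈ s, g i = j} f i`. -/
theorem sum_eq_sum_image_fiber {ι κ M : Type*} [DecidableEq κ] [AddCommMonoid M] (s : Finset ι)
    (g : ι → κ) (f : ι → M) :
    ∑ i ∈ s, f i = ∑ j ∈ s.image g, ∑ i ∈ s.filter (fun i => g i = j), f i :=
  (Finset.sum_fiberwise_of_maps_to (fun _ h => Finset.mem_image_of_mem g h) f).symm

/-! ## The angle sum of a fan triangle -/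

section TriAngle

open scoped Classical

variable {X : Finset (EuclideanSpace ℝ (Fin 3))}

/-- **The angle sum of a fan triangle** `t`: the fan angles at the reversed darts of the three
darts whose face triangle is `t` (the three interior angles of `t`). -/
def triAngleSum (X : Finset (EuclideanSpace ℝ (Fin 3))) (t : Finset (EuclideanSpace ℝ (Fin 3))) :
    ℝ :=
  ∑ d ∈ (univ : Finset ↥(hullDarts X)).filter (fun d => faceTri X d.1 = t), dartWeight X (inv X d)

variable {hX1 : ∀ y ∈ X, ‖y‖ = 1}
  {h0 : (0 : EuclideanSpace ℝ (Fin 3)) ∈ interior (convexHull ℝ (X : Set _))}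

/-- The full face of a dart is the fibre of `faceTri` through it. -/
theorem face_univ_eq_filter_faceTri (d : ↥(hullDarts X)) :
    RotSys.face (rot hX1 h0) (inv X) univ d = univ.filter fun d' => faceTri X d'.1 = faceTri X d.1 := by
  ext d'
  rw [RotSys.mem_face, mem_filter, sameCycle_phi_iff]
  simp only [mem_univ, true_and]
  exact eq_comm

/-- **The angle sum of the face triangle of `d` is the corner sum of the full face of `d`.** -/
theorem triAngleSum_faceTri_eq_faceSum (d : ↥(hullDarts X)) :
    triAngleSum X (faceTri X d.1) =
      RotSys.faceSum (rot hX1 h0) (inv X) (dartWeight X) univ d := by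
  unfold triAngleSum RotSys.faceSum
  rw [face_univ_eq_filter_faceTri]
  exact sum_congr rfl fun y _ => (RotSys.cornerAt_univ _ _ _).symm

/-- The fibre of `faceTri` in the dart type has three darts. -/
theorem card_filter_faceTri_subtype (hX1 : ∀ y ∈ X, ‖y‖ = 1)
    (h0 : (0 : EuclideanSpace ℝ (Fin 3)) ∈ interior (convexHull ℝ (X : Set _)))
    {t : Finset (EuclideanSpace ℝ (Fin 3))} (ht : t ∈ fanTriSets X) :
    ((univ : Finset ↥(hullDarts X)).filter fun d => faceTri X d.1 = t).card = 3 := by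
  refine Eq.trans ?_ (card_filter_faceTri_eq hX1 h0 ht)
  refine Finset.card_bij (fun d _ => d.1) (fun d hd => ?_) (fun d₁ _ d₂ _ h => Subtype.ext h)
    (fun p hp => ?_)
  · rw [mem_filter] at hd ⊢; exact ⟨d.2, hd.2⟩
  · rw [mem_filter] at hp
    exact ⟨⟨p, hp.1⟩, mem_filter.2 ⟨mem_univ _, hp.2⟩, rfl⟩

/-- **Girard for fan triangles (weak form): `triAngleSum t − π ≥ 0`.** -/
theorem triAngleSum_sub_pi_nonneg (hX1 : ∀ y ∈ X, ‖y‖ = 1)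
    (h0 : (0 : EuclideanSpace ℝ (Fin 3)) ∈ interior (convexHull ℝ (X : Set _)))
    {t : Finset (EuclideanSpace ℝ (Fin 3))} (ht : t ∈ fanTriSets X) :
    0 ≤ triAngleSum X t - Real.pi := by
  obtain ⟨p, hp, rfl⟩ := exists_faceTri_eq hX1 h0 ht
  have h := excess_univ_nonneg (hX1 := hX1) (h0 := h0) ⟨p, hp⟩
  unfold RotSys.excess at h
  rw [← triAngleSum_faceTri_eq_faceSum (hX1 := hX1) (h0 := h0) ⟨p, hp⟩,
    face_univ_eq_filter_faceTri, card_filter_faceTri_subtype hX1 h0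
      (faceTri_mem_fanTriSets hX1 h0 hp)] at h
  norm_num at h
  linarith

/-- **Strict Girard for fan triangles: `triAngleSum t − π > 0`.** -/
theorem triAngleSum_sub_pi_pos (hX1 : ∀ y ∈ X, ‖y‖ = 1)
    (h0 : (0 : EuclideanSpace ℝ (Fin 3)) ∈ interior (convexHull ℝ (X : Set _)))
    {t : Finset (EuclideanSpace ℝ (Fin 3))} (ht : t ∈ fanTriSets X) :
    0 < triAngleSum X t - Real.pi := by
  obtain ⟨p, hp, rfl⟩ := exists_faceTri_eq hX1 h0 ht
  have h := excess_univ_pos (hX1 := hX1) (h0 := h0) ⟨p, hp⟩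
  unfold RotSys.excess at h
  rw [← triAngleSum_faceTri_eq_faceSum (hX1 := hX1) (h0 := h0) ⟨p, hp⟩,
    face_univ_eq_filter_faceTri, card_filter_faceTri_subtype hX1 h0
      (faceTri_mem_fanTriSets hX1 h0 hp)] at h
  norm_num at h
  linarith

end TriAngle


end Summit.Ventures.Crystal3D

end
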